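import Summits.ResolutionOfSingularities.ResolutionOfSingularities.Theorems.WildQuotientsSummitReductionStubPairQuasiSplitNormalFormLemmas
import Summits.ResolutionOfSingularities.ResolutionOfSingularities.Theorems.WildQuotientsSummitReductionStubPairQuasiSplitNormalFormLemmas3
import Summits.ResolutionOfSingularities.ResolutionOfSingularities.Theorems.WildQuotientsSummitReductionStubPairQuasiSplitNormalFormLemmas7
import Literature.AlgebraicGeometry.Resolution.PowerSeriesRegularLocal
import HarnessLib

/-!
# `WildQuotients.SummitReduction` (stmt-ResolutionOfSingularities-16324), line `FramePerfect`, skeleton v8: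
# stub `stub_pair_quasiSplitNormalForm` (N) — helper file 4: de Jong 1996, 3.5 / 4.25 (ii) at the
# singular closed points of a QUASI-SPLIT semi-stable pair with `codim(Sing X, X) ≥ 3`, any field

Route `ResolutionOfSingularities/WildQuotients`, crux `SummitReduction`; sub-goals of the registered
stub `stub_pair_quasiSplitNormalForm` of the line skeleton `Cruxes/SummitReduction/Lines/FramePerfect.lean`
(v8, lead c4). Worker file.

De Jong 1996, 3.5 (p. 64): "Looking at the equations `Q - t₁^{n₁} ⋯ t_r^{n_r}` for a point
`x ∈ Sing(X)` as in 3.3, we see that we must have `nᵢ ∈ {0, 1}`. Thus `B` looks like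
`A'⟦u, v⟧/(Q - t₁ ⋯ t_s)` for some `2 ≤ s ≤ r` and `D` at `s` is defined by `t₁ ⋯ t_r = 0`."
The tree proves this as field (ii) of Situation 4.25 (`DeJong1996CodimThreeNodalForm_holds`) over an
ALGEBRAICALLY CLOSED field, with the coefficient field `k`. Here, from the quasi-split nodal structure
of `…Lemmas3.lean` (`𝒪̂_{X,x} ≅ K⟦u, v, T⟧/(uv - ∏ Tᵢ^{νᵢ})` over `K = κ(f x)`), the same is
derived in the COEFFICIENT-FREE form of `DeJong1997.QuasiSplitNormalFormPair` (field
`exists_ringEquiv_of_not_isRegularLocalRing`): `𝒪̂_{X,x} ≅ A⟦u, v⟧/(uv - ∏_{i<s} tᵢ)` for the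
regular local ring `A = K⟦T₁, …, T_{d-1}⟧` with its variables as regular system of parameters,
`2 ≤ s ≤ r ≤ d - 1`, the completed ideal of the boundary going to `(∏_{i<r} tᵢ)`:

* `exists_nodeDeformationRing_of_formalNodeRing` — from a presentation as in `…Lemmas3.lean` at a
  singular closed point to field (ii): `d = m + 1` (`ringKrullDim_stalk_eq_base_add_one_of_isClosed`),
  `Σ νᵢ ≥ 2` ("if `Σ nᵢ = 1`, then the point `x` is regular on `X`"), `νᵢ ≤ 1`
  (`exponent_le_one_of_codimThree` of `…Lemmas7.lean`), the boundary ideal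
  `(∏_{i<r} Tᵢ)` (`stalkIdeal_vanishingIdeal_boundary_of_not_isRegularLocalRing`), renumbering
  (`exists_ringEquiv_nodalPowRing`) and rebracketing `K⟦u, v, T⟧/(uv - ∏_{i<s} Tᵢ) ≅
  K⟦T⟧⟦u, v⟧/(uv - ∏_{i<s} Tᵢ)` (`toFormalNodeRing`);
* `exists_nodeDeformationRing_of_quasiSplit` — field (ii) at a singular closed point carrying a
  quasi-split datum.
-/

set_option linter.dupNamespace false

noncomputable section

open CategoryTheory CategoryTheory.Limits AlgebraicGeometry TopologicalSpace
open Literature.AlgebraicGeometry.Resolution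
open Literature.AlgebraicGeometry
open IsLocalRing Scheme.IdealSheafData

namespace Summit.ResolutionOfSingularities.ResolutionOfSingularities.Theorems

universe u

section Local

variable {k : Type u} [Field k] {X Y : Scheme.{u}} {f : X ⟶ Y} {g : Y ⟶ Spec (.of k)}
  {D : Set Y} {n : ℕ} {τ : Fin n → (Y ⟶ X)}

/-- **de Jong 1996, 3.5 / 4.25 (ii) in coefficient-free form, from a formal-node presentation at a
singular closed point.** For a pair in Situation 4.23 over any field with `codim(Sing X, X) ≥ 3`
and `dim X = d`, a closed point `x` with `𝒪_{X,x}` not regular, a regular system of parameters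
`t₁, …, t_m` of `𝒪_{Y,f x}` with `I(D)_{f x} = (∏_{i<ρ} tᵢ)`, and a presentation
`e : 𝒪̂_{X,x} ≅ K⟦u, v, T⟧/(uv - ∏ Tᵢ^{νᵢ})` with `νᵢ = 0` for `i ≥ ρ` and `f^#(tᵢ) ↦ Tᵢ`: there are
`2 ≤ s ≤ r ≤ d - 1` and an isomorphism `𝒪̂_{X,x} ≅ A⟦u, v⟧/(uv - ∏_{i<s} Xᵢ)` with
`A = K⟦X₁, …, X_{d-1}⟧` (regular local of dimension `d - 1`, the variables a regular system of
parameters) carrying the completed ideal of `Z = ⋃ τᵢ(Y) ∪ f⁻¹(D)` to `(∏_{i<r} Xᵢ)`. Proof: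
`d = m + 1`; `Σ νᵢ ≥ 2` as `x` is singular ("if `Σ nᵢ = 1`, then the point `x` is regular");
`νᵢ ≤ 1` (`exponent_le_one_of_codimThree`); the boundary ideal is `(∏_{i<ρ} Tᵢ)`
(`stalkIdeal_vanishingIdeal_boundary_of_not_isRegularLocalRing`); renumbering
(`exists_ringEquiv_nodalPowRing`) and rebracketing (`toFormalNodeRing`).
[cite: DeJong1996, 3.5 and 4.25 (ii), pp. 64, 75] [cite: DeJong1997, proof of Prop. 5.11, p. 619] -/
theorem exists_nodeDeformationRing_of_formalNodeRing (hS : DeJong1996.SemiStablePair f g D τ)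
    (hcodim : ∀ x : X, ¬ IsRegularLocalRing (X.presheaf.stalk x) →
      (3 : WithBot ℕ∞) ≤ ringKrullDim (X.presheaf.stalk x))
    {d : ℕ} (hd : topologicalKrullDim X = d) {x : X} (hx : IsClosed ({x} : Set X))
    (hreg : ¬ IsRegularLocalRing (X.presheaf.stalk x))
    {m ρ : ℕ} (t : Fin m → Y.presheaf.stalk (f x)) (hρm : ρ ≤ m)
    (hdimA : ringKrullDim (Y.presheaf.stalk (f x)) = m)
    (hIA : stalkIdeal (vanishingIdeal ⟨D, hS.isStrictNormalCrossingsDivisor.isClosed⟩) (f x) =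
      Ideal.span {∏ i ∈ Finset.univ.filter (fun i : Fin m => i.val < ρ), t i})
    {K : Type u} [Field K] {ν : Fin m → ℕ}
    (e : AdicCompletion (maximalIdeal (X.presheaf.stalk x)) (X.presheaf.stalk x) ≃+*
      DeJong1996.FormalNodeRing K m ν)
    (hν : ∀ i : Fin m, ρ ≤ i.val → ν i = 0)
    (he : ∀ i : Fin m, e (algebraMap _ _ ((f.stalkMap x).hom (t i))) =
      Ideal.Quotient.mk _ (MvPowerSeries.X (Sum.inr i))) :
    ∃ (A : Type u) (_ : CommRing A) (_ : IsRegularLocalRing A) (t' : Fin (d - 1) → A) (s r : ℕ),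
      Ideal.span (Set.range t') = maximalIdeal A ∧ ringKrullDim A = (d - 1 : ℕ) ∧
      2 ≤ s ∧ s ≤ r ∧ r ≤ d - 1 ∧
      ∃ e' : AdicCompletion (maximalIdeal (X.presheaf.stalk x)) (X.presheaf.stalk x) ≃+*
          DeJong1996.NodeDeformationRing A
            (∏ i ∈ Finset.univ.filter (fun i : Fin (d - 1) => i.val < s), t' i),
        ∀ (U : X.affineOpens) (hU : x ∈ (U : X.Opens)),
          (completedStalkIdeal (vanishingIdeal ⟨DeJong1996.semiStableBoundary f D τ,
              hS.isClosed_semiStableBoundary⟩) x U hU).map e'.toRingHom =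
            Ideal.span {DeJong1996.NodeDeformationRing.ofBase A _
              (∏ i ∈ Finset.univ.filter (fun i : Fin (d - 1) => i.val < r), t' i)} := by
  classical
  haveI := hS.isIntegral
  haveI := hS.locallyOfFiniteType
  haveI := hS.isNoetherian
  -- `d = m + 1`
  have hdimB : ringKrullDim (X.presheaf.stalk x) = (m + 1 : ℕ) := by
    rw [ringKrullDim_stalk_eq_base_add_one_of_isClosed hS hx, hdimA, Nat.cast_succ]
  have hd' : ringKrullDim (X.presheaf.stalk x) = d := by
    rw [ringKrullDim_stalk_eq_of_isClosed (f ≫ g) hx, hd]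
  obtain rfl : d = m + 1 := by
    rw [hdimB] at hd'
    exact_mod_cast hd'.symm
  -- `Σ νᵢ ≥ 2`
  have hν0 : ∃ i, ν i ≠ 0 := DeJong1996.FormalNodeRing.exists_ne_zero_of_ringEquiv e
  have hsum : 2 ≤ ∑ i, ν i := by
    by_contra hlt
    obtain ⟨i₀, hi₀⟩ := DeJong1996.FormalNodeRing.eq_single_of_sum_le_one hν0 (by omega)
    obtain ⟨m, rfl⟩ : ∃ m', m = m' + 1 := ⟨m - 1, by have := i₀.isLt; omega⟩
    subst hi₀
    haveI := isNoetherianRing_adicCompletion_maximalIdeal (X.presheaf.stalk x)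
    haveI : IsRegularLocalRing (AdicCompletion (maximalIdeal (X.presheaf.stalk x))
        (X.presheaf.stalk x)) :=
      DeJong1996.FormalNodeRing.isRegularLocalRing_of_single K i₀ e
        (by rw [ringKrullDim_adicCompletion, hdimB])
    exact hreg (isRegularLocalRing_of_adicCompletion_equiv rfl (RingEquiv.refl _))
  -- the presentation in the `NodalPowRing` spelling of the model (the same ring)
  let eP : AdicCompletion (maximalIdeal (X.presheaf.stalk x)) (X.presheaf.stalk x) ≃+*
      DeJong1996.NodalPowRing K m ν := e
  -- `νᵢ ≤ 1`
  have hle : ∀ i, ν i ≤ 1 := fun i => exponent_le_one_of_codimThree hS hcodim eP i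
  -- `s = Σ νᵢ ≤ ρ`: the non-zero exponents sit at indices `< ρ`
  have hsr : ∑ i, ν i ≤ ρ := by
    calc ∑ i, ν i = ∑ i ∈ Finset.univ.filter (fun i : Fin m => i.val < ρ), ν i := by
          rw [Finset.sum_filter]
          refine Finset.sum_congr rfl fun i _ => ?_
          by_cases hi : i.val < ρ
          · rw [if_pos hi]
          · rw [if_neg hi, hν i (not_lt.mp hi)]
      _ ≤ ∑ i ∈ Finset.univ.filter (fun i : Fin m => i.val < ρ), 1 :=
          Finset.sum_le_sum fun i _ => hle i
      _ = (Finset.univ.filter (fun i : Fin m => i.val < ρ)).card := by simp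
      _ = Fintype.card {i : Fin m // i.val < ρ} := (Fintype.card_subtype _).symm
      _ = ρ := by rw [← Fintype.card_congr (Fin.castLEquiv hρm), Fintype.card_fin]
  -- the completed ideal of `Z` under `e` is `(∏_{i<ρ} Tᵢ)`
  have hbdry : ∀ (U : X.affineOpens) (hU : x ∈ (U : X.Opens)),
      (completedStalkIdeal (vanishingIdeal ⟨DeJong1996.semiStableBoundary f D τ,
          hS.isClosed_semiStableBoundary⟩) x U hU).map eP.toRingHom =
        Ideal.span {DeJong1996.nodalPowBoundary K m ν ρ} := by
    intro U hU
    rw [completedStalkIdeal_eq_map_stalkIdeal,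
      hS.stalkIdeal_vanishingIdeal_boundary_of_not_isRegularLocalRing hreg, hIA, Ideal.map_span,
      Set.image_singleton, Ideal.map_span, Set.image_singleton, Ideal.map_span,
      Set.image_singleton]
    refine congrArg (fun a => Ideal.span {a}) ?_
    rw [map_prod, map_prod, RingEquiv.toRingHom_eq_coe, RingHom.coe_coe, map_prod,
      DeJong1996.nodalPowBoundary, map_prod]
    exact Finset.prod_congr rfl fun i _ => he i
  -- renumbering: `K⟦u, v, T⟧/(uv - ∏ Tᵢ^{νᵢ}) ≅ K⟦u, v, T⟧/(uv - T₁ ⋯ T_s)`, `s = Σ νᵢ`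
  obtain ⟨θ, hθ⟩ := DeJong1996.exists_ringEquiv_nodalPowRing K ν hle hν hρm
  -- rebracketing over `Λ = K⟦T⟧` (`s = Σ νᵢ`)
  set Λ := MvPowerSeries (Fin m) K with hΛ
  let ind : Fin m → ℕ := fun i => if i.val < ∑ j, ν j then 1 else 0
  let ψ₁ : DeJong1996.NodalFamilyRing K m (∑ j, ν j) ≃+* DeJong1996.FormalNodeRing K m ind :=
    (DeJong1996.formalNodeRingEquivNodalFamilyRing K m (∑ j, ν j)).symm
  let ψ₂ : DeJong1996.FormalNodeRing K m ind ≃+*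
      DeJong1996.NodeDeformationRing Λ (∏ i, MvPowerSeries.X i ^ ind i) :=
    (DeJong1996.NodeDeformationRing.toFormalNodeRing K m ind).symm
  have hprodind : (∏ i, (MvPowerSeries.X i : Λ) ^ ind i) =
      ∏ i ∈ Finset.univ.filter (fun i : Fin m => i.val < ∑ j, ν j), MvPowerSeries.X i := by
    rw [Finset.prod_filter]
    refine Finset.prod_congr rfl fun i _ => ?_
    simp only [ind]
    split_ifs <;> simp
  let ψ₃ : DeJong1996.NodeDeformationRing Λ (∏ i, MvPowerSeries.X i ^ ind i) ≃+*
      DeJong1996.NodeDeformationRing Λ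
        (∏ i ∈ Finset.univ.filter (fun i : Fin m => i.val < ∑ j, ν j), MvPowerSeries.X i) :=
    Ideal.quotEquivOfEq (by rw [hprodind])
  have hψ₁ : ∀ p, ψ₁ (Ideal.Quotient.mk _ p) = Ideal.Quotient.mk _ p := fun p =>
    (RingEquiv.symm_apply_eq _).mpr rfl
  have hψ₂ : ∀ i : Fin m, ψ₂ (Ideal.Quotient.mk _ (MvPowerSeries.X (Sum.inr i))) =
      Ideal.Quotient.mk _ (MvPowerSeries.C (MvPowerSeries.X i)) := fun i =>
    (RingEquiv.symm_apply_eq _).mpr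
      (DeJong1996.NodeDeformationRing.toFormalNodeRing_mk_C_X K m ind i).symm
  let e' := (((eP.trans θ).trans ψ₁).trans ψ₂).trans ψ₃
  have hcomp : e'.toRingHom =
      ψ₃.toRingHom.comp (ψ₂.toRingHom.comp (ψ₁.toRingHom.comp (θ.toRingHom.comp eP.toRingHom))) :=
    rfl
  -- the completed ideal of `Z` under `e'` (in the `Fin m` indexing; `d - 1 = m` definitionally)
  have hfinal : ∀ (U : X.affineOpens) (hU : x ∈ (U : X.Opens)),
      (completedStalkIdeal (vanishingIdeal ⟨DeJong1996.semiStableBoundary f D τ,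
          hS.isClosed_semiStableBoundary⟩) x U hU).map e'.toRingHom =
        Ideal.span {DeJong1996.NodeDeformationRing.ofBase Λ _
          (∏ i ∈ Finset.univ.filter (fun i : Fin m => i.val < ρ), MvPowerSeries.X i)} := by
    intro U hU
    rw [hcomp, ← Ideal.map_map, ← Ideal.map_map, ← Ideal.map_map, ← Ideal.map_map, hbdry U hU,
      Ideal.map_span, Set.image_singleton, Ideal.map_span, Set.image_singleton, Ideal.map_span,
      Set.image_singleton, Ideal.map_span, Set.image_singleton]
    refine congrArg (fun a => Ideal.span {a}) ?_
    change ψ₃ (ψ₂ (ψ₁ (θ (DeJong1996.nodalPowBoundary K m ν ρ)))) = _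
    rw [hθ, DeJong1996.nodalFamilyBoundary, hψ₁, map_prod, map_prod, map_prod, map_prod]
    refine Finset.prod_congr rfl fun i _ => ?_
    rw [hψ₂ i]
    change Ideal.quotEquivOfEq _ (Ideal.Quotient.mk _ _) = _
    rw [Ideal.quotEquivOfEq_mk, DeJong1996.NodeDeformationRing.ofBase_apply]
  exact ⟨Λ, inferInstance, (isRegularLocalRing_mvPowerSeries_fin K m).1, MvPowerSeries.X, ∑ j, ν j, ρ,
    (maximalIdeal_mvPowerSeries_eq_span_range_X K).symm, (isRegularLocalRing_mvPowerSeries_fin K m).2,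
    hsum, hsr, hρm, e', hfinal⟩

end Local

/-- **de Jong 1996, 3.5 / 4.25 (ii) at a singular closed point of a QUASI-SPLIT semi-stable pair
with `codim(Sing X, X) ≥ 3`, over an arbitrary field** (field `exists_ringEquiv_of_not_isRegularLocalRing`
of `DeJong1997.QuasiSplitNormalFormPair` for the pair `(X, ⋃ τᵢ(Y) ∪ f⁻¹(D))`): at a closed point
`x` with `𝒪_{X,x}` not regular carrying a quasi-split datum, there are a regular local ring `A`
of dimension `d - 1` with regular system of parameters `t`, integers `2 ≤ s ≤ r ≤ d - 1` and
`𝒪̂_{X,x} ≅ A⟦u, v⟧/(uv - ∏_{i<s} tᵢ)` carrying the completed ideal of the boundary to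
`(∏_{i<r} tᵢ)` — by the quasi-split nodal structure (`exists_formalNodeRing_equiv_of_quasiSplit`)
on a regular system of parameters of `𝒪_{Y,f x}` adapted to `D` and
`exists_nodeDeformationRing_of_formalNodeRing`. ("The types of complete local rings that we have
now are `A⟦u, v⟧/(uv - t₁ ⋯ t_s)`", de Jong 1997, p. 619.)
[cite: DeJong1996, 3.5, p. 64] [cite: DeJong1997, proof of Prop. 5.11, p. 619] -/
theorem exists_nodeDeformationRing_of_quasiSplit {k : Type u} [Field k] {X Y : Scheme.{u}}
    {f : X ⟶ Y} {g : Y ⟶ Spec (.of k)} {D : Set Y} {n : ℕ} {τ : Fin n → (Y ⟶ X)}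
    (hS : DeJong1996.SemiStablePair f g D τ)
    (hcodim : ∀ x : X, ¬ IsRegularLocalRing (X.presheaf.stalk x) →
      (3 : WithBot ℕ∞) ≤ ringKrullDim (X.presheaf.stalk x))
    {d : ℕ} (hd : topologicalKrullDim X = d) {x : X} (hx : IsClosed ({x} : Set X))
    (hreg : ¬ IsRegularLocalRing (X.presheaf.stalk x))
    (e₁ : AdicCompletion
        ((maximalIdeal (X.presheaf.stalk x)).map (Ideal.Quotient.mk
          ((maximalIdeal (Y.presheaf.stalk (f x))).map (f.stalkMap x).hom)))
        (X.presheaf.stalk x ⧸ (maximalIdeal (Y.presheaf.stalk (f x))).map (f.stalkMap x).hom) ≃+*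
      MvPowerSeries (Fin 2) (Y.presheaf.stalk (f x) ⧸ maximalIdeal (Y.presheaf.stalk (f x))) ⧸
        Ideal.span {(MvPowerSeries.X 0 * MvPowerSeries.X 1 :
          MvPowerSeries (Fin 2) (Y.presheaf.stalk (f x) ⧸ maximalIdeal (Y.presheaf.stalk (f x))))})
    (he₁ : e₁.toRingHom.comp ((algebraMap (X.presheaf.stalk x ⧸
        (maximalIdeal (Y.presheaf.stalk (f x))).map (f.stalkMap x).hom) _).comp
        (Ideal.quotientMap ((maximalIdeal (Y.presheaf.stalk (f x))).map (f.stalkMap x).hom)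
          (f.stalkMap x).hom Ideal.le_comap_map)) =
      algebraMap (Y.presheaf.stalk (f x) ⧸ maximalIdeal (Y.presheaf.stalk (f x))) _) :
    ∃ (A : Type u) (_ : CommRing A) (_ : IsRegularLocalRing A) (t' : Fin (d - 1) → A) (s r : ℕ),
      Ideal.span (Set.range t') = maximalIdeal A ∧ ringKrullDim A = (d - 1 : ℕ) ∧
      2 ≤ s ∧ s ≤ r ∧ r ≤ d - 1 ∧
      ∃ e' : AdicCompletion (maximalIdeal (X.presheaf.stalk x)) (X.presheaf.stalk x) ≃+*
          DeJong1996.NodeDeformationRing A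
            (∏ i ∈ Finset.univ.filter (fun i : Fin (d - 1) => i.val < s), t' i),
        ∀ (U : X.affineOpens) (hU : x ∈ (U : X.Opens)),
          (completedStalkIdeal (vanishingIdeal ⟨DeJong1996.semiStableBoundary f D τ,
              hS.isClosed_semiStableBoundary⟩) x U hU).map e'.toRingHom =
            Ideal.span {DeJong1996.NodeDeformationRing.ofBase A _
              (∏ i ∈ Finset.univ.filter (fun i : Fin (d - 1) => i.val < r), t' i)} := by
  -- a regular system of parameters of `𝒪_{Y,f x}` adapted to `D`
  obtain ⟨m, ρ, t, hρm, hdimA, hspanA, hIA, -⟩ := hS.exists_rsop_stalkIdeal_base' (f x)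
  -- the quasi-split nodal structure
  obtain ⟨ν, e, hν, he⟩ := exists_formalNodeRing_equiv_of_quasiSplit hS e₁ he₁ t hspanA hdimA hIA
  exact exists_nodeDeformationRing_of_formalNodeRing hS hcodim hd hx hreg t hρm hdimA hIA e hν he

end Summit.ResolutionOfSingularities.ResolutionOfSingularities.Theorems

end
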